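import Literature.NumberTheory.NumberFields.RayClassFieldAdicCharacterTower
import Literature.NumberTheory.NumberFields.RayClassFieldAdicCharacterDivision
import HarnessLib

/-!
# The `v`-ray class towers `U_n = Gal(K̄/K(𝔪'v^{n+1}))` AS SUBGROUPS OF `Γ_K` (de Shalit's `𝒢 = Gal(F_∞/K)`
# rather than `G = Gal(F_∞/F)`): the ambient tower for the induction of the measure `μ(𝔣)` from
# `Gal(K̄/K(𝔪))` to `Γ_K` (de Shalit 1987, II.4.1, II.4.6, II.4.12)

Sequel of `RayClassFieldAdicCharacterTower.lean`, whose `rayAdicTower h𝔪' v` is the tower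
`Gal(K̄/K(𝔪'v^{n+1}))` read INSIDE the subgroup `G = Gal(K̄/K(𝔪))` (the domain of the `v`-adic Artin
character `κ_v`) — the currency of the one-`𝔓` assembly of de Shalit II.4.12
(`…Theorems.PrintCf2.EllipticUnitsLocal.exists_groupDistribution_twisting_eq_induce_ellipticUnitsLocal`).
De Shalit's measure `μ(𝔣)` lives on `𝒢 = Gal(K(𝔣𝔭^∞)/K) ⊋ Gal(K(𝔣𝔭^∞)/K(𝔣))` (II.4.1: "`𝒢 = Gal(F_∞/K)`,
`G = Gal(F_∞/F)`"; II.4.6: "`i : 𝒰 → Λ(𝒢, R̂)` is a `𝒢`-homomorphism"; I.3.4: the coset-by-coset extension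
over `𝒢/G = Gal(F/K)`).  The generic induction `GroupDistribution.induceFrom`
(`ProfiniteGroupDistributionInduceFromSubgroup.lean`) needs the SAME tower as a tower of `Γ_K` together with
the dictionary `V_n = U_n ∩ G`; THIS file supplies it:

* §1 `absRayAdicTower h𝔪' v : SubgroupTower Γ_K`, `U_n = Gal(K̄/K(𝔪'v^{n+1}))` (normal, open, finite
  index), with ★ `rayAdicTower_U_eq_subgroupOf` — the relative tower IS its restriction to `Gal(K̄/K(𝔪))`
  (definitionally; the `hV` of `induceFrom`), `absRayAdicTower_U_le_ker` (`U_n ≤ Gal(K̄/K(𝔪))` for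
  `𝔪' ⊆ 𝔪`; the `hH` of `induceFrom`), and `commutator_mem_absRayAdicTower_U` (all `Γ_K/U_n` abelian — the
  `hcomm` of the division theorem on `Γ_K`);
* §2 ★ `ker_le_absRayAdicTower_U_zero_of_padicIntEquiv_two` — at a place `v` with `𝒪_v ≅ ℤ₂` (degree one
  above `2`), `Gal(K̄/K(𝔪)) ≤ Gal(K̄/K(𝔪v))`, i.e. **`K(𝔪v) = K(𝔪)`** (`Gal(K(𝔪v)/K(𝔪)) ≅ 𝒪_vˣ/(1+v𝒪_v) =
  𝔽₂ˣ = 1` when `w_𝔪 = 1`): the subgroup `H = Gal(K̄/K(𝔪))` IS the top level `U_0` of the tower — the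
  indicator-free case of `integral_induceFrom_of_mul_of_le` (de Shalit II.4.17: at `p = 2` the group
  `Δ ≅ 𝔽_pˣ` of II.4.1 is trivial), and `absRayAdicTower_U_zero_eq_ker`.

One definition with body (`absRayAdicTower`); theorems otherwise; no named facts, no instances, no `sorry`.

## References

* [deShalit1987] E. de Shalit, *Iwasawa theory of elliptic curves with complex multiplication* (1987),
  II.4.1 (p. 56), II.4.6 (p. 59), II.4.12 (p. 66–67), II.4.17 (p. 77–78), I.3.4 (p. 18), II.1.9 (p. 43).
* [NeukirchANT1999] J. Neukirch, *Algebraic Number Theory* (1999), Ch. VI §6 (6.2)–(6.6).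
-/

noncomputable section

open NumberField IsDedekindDomain IsDedekindDomain.HeightOneSpectrum Field
open scoped nonZeroDivisors Classical

namespace Literature.NumberTheory.NumberFields

open Literature.NumberTheory.GaloisRepresentations
open Literature.NumberTheory.EllipticCurves (SubgroupTower)

variable {K : Type} [Field K] [NumberField K]

/-! ### §1. The tower `Gal(K̄/K(𝔪'v^{n+1}))` in `Γ_K` and its restriction to `Gal(K̄/K(𝔪))` -/

section Tower

variable {𝔪 𝔪' : Ideal (𝓞 K)} (h𝔪' : 𝔪' ≠ ⊥) (v : HeightOneSpectrum (𝓞 K))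

/-- **The `v`-ray class tower of modulus `𝔪'` in `Γ_K`**: `U_n = Gal(K̄/K(𝔪'v^{n+1}))` as finite-index
subgroups of the absolute Galois group — de Shalit's `Gal(F_∞/F_n) ≤ 𝒢 = Gal(F_∞/K)` pulled back to
`Γ_K`, `F_n = K(𝔣𝔭^n)`, `𝔣 = 𝔪'`. [cite: deShalit1987, II.4.1 (p. 56), II.4.12 Remark (i) (p. 67)] -/
def absRayAdicTower : SubgroupTower (absoluteGaloisGroup K) where
  U n := (absRestrictNormalHom (rayClassField K (𝔪' * v.asIdeal ^ (n + 1)))).ker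
  finiteIndex n := by
    haveI := Subgroup.quotient_finite_of_isOpen _
      (isOpen_ker_absRestrictNormalHom (rayClassField K (𝔪' * v.asIdeal ^ (n + 1))))
    exact Subgroup.finiteIndex_of_finite_quotient
  succ_le n := ker_absRestrictNormalHom_anti_of_le (rayClassField_mul_pow_succ_le_succ v h𝔪' n)

/-- The levels of the tower (unfolding). [cite: deShalit1987, II.4.1 (p. 56)] -/
theorem absRayAdicTower_U (n : ℕ) :
    (absRayAdicTower h𝔪' v).U n = (absRestrictNormalHom (rayClassField K (𝔪' * v.asIdeal ^ (n + 1)))).ker :=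
  rfl

/-- Membership in the levels of the tower. [cite: deShalit1987, II.4.1 (p. 56)] -/
theorem mem_absRayAdicTower_U_iff (n : ℕ) (σ : absoluteGaloisGroup K) :
    σ ∈ (absRayAdicTower h𝔪' v).U n ↔
      σ ∈ (absRestrictNormalHom (rayClassField K (𝔪' * v.asIdeal ^ (n + 1)))).ker :=
  Iff.rfl

/-- The levels are normal in `Γ_K`. [cite: deShalit1987, I.3.1 (p. 16)] -/
theorem absRayAdicTower_U_normal (n : ℕ) : ((absRayAdicTower h𝔪' v).U n).Normal := by
  rw [absRayAdicTower_U]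
  infer_instance

/-- The levels are open in `Γ_K`. [cite: deShalit1987, II.4.12 Remark (i) (p. 67)] -/
theorem isOpen_absRayAdicTower_U (n : ℕ) :
    IsOpen ((absRayAdicTower h𝔪' v).U n : Set (absoluteGaloisGroup K)) :=
  isOpen_ker_absRestrictNormalHom _

/-- ★ **The relative tower is the restriction of the absolute one to `Gal(K̄/K(𝔪))`** — DEFINITIONALLY:
`(rayAdicTower h𝔪' v).U n = ((absRayAdicTower h𝔪' v).U n) ∩ Gal(K̄/K(𝔪))` (the `hV` of
`GroupDistribution.induceFrom`). [cite: deShalit1987, II.4.1 (p. 56), I.3.4 (p. 18)] -/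
theorem rayAdicTower_U_eq_subgroupOf (n : ℕ) :
    (rayAdicTower (𝔪 := 𝔪) h𝔪' v).U n =
      ((absRayAdicTower h𝔪' v).U n).subgroupOf (absRestrictNormalHom (rayClassField K 𝔪)).ker :=
  rfl

/-- **Every level lies in `Gal(K̄/K(𝔪))`** when `𝔪' ⊆ 𝔪` (`K(𝔪) ⊆ K(𝔪') ⊆ K(𝔪'v^{n+1})`); in particular
`U_0 ≤ H` (the `hH` of `GroupDistribution.induceFrom`). [cite: deShalit1987, II.4.1 (p. 56)] [cite: NeukirchANT1999, Ch. VI §6 Cor. (6.6)] -/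
theorem absRayAdicTower_U_le_ker (hle : 𝔪' ≤ 𝔪) (n : ℕ) :
    (absRayAdicTower h𝔪' v).U n ≤ (absRestrictNormalHom (rayClassField K 𝔪)).ker :=
  ker_absRestrictNormalHom_anti_of_le
    (rayClassField_le_of_le (mul_ne_zero h𝔪' (pow_ne_zero _ v.ne_bot)) (Ideal.mul_le_right.trans hle))

/-- A member of a level of the relative tower, read in `Γ_K`, is a member of the same level of the absolute
tower. [cite: deShalit1987, II.4.1 (p. 56)] -/
theorem coe_mem_absRayAdicTower_U_iff (n : ℕ) (σ : ↥(absRestrictNormalHom (rayClassField K 𝔪)).ker) :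
    (σ : absoluteGaloisGroup K) ∈ (absRayAdicTower h𝔪' v).U n ↔ σ ∈ (rayAdicTower (𝔪 := 𝔪) h𝔪' v).U n :=
  (mem_rayAdicTower_U_iff h𝔪' v n σ).symm

/-- **All commutators of `Γ_K` lie in every level** (`K(𝔪'v^{n+1})/K` is abelian) — the `hcomm` of
`GroupDistribution.exists_twisting_μ_eq_forall_of_units` / `…_induceFrom` on `Γ_K`.
[cite: deShalit1987, II.4.12 (p. 66–67)] [cite: NeukirchANT1999, Ch. VI §6 Def. (6.2)] -/
theorem commutator_mem_absRayAdicTower_U (n : ℕ) (x y : absoluteGaloisGroup K) :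
    x * y * x⁻¹ * y⁻¹ ∈ (absRayAdicTower h𝔪' v).U n := by
  rw [absRayAdicTower_U, ← commutatorElement_def]
  exact commutator_le_ker_absRestrictNormalHom_of_isAbelianGalois _
    (Subgroup.commutator_mem_commutator (Subgroup.mem_top _) (Subgroup.mem_top _))

/-- The `hcent` form: every `U_s` is central in `Γ_K` modulo every level. [cite: deShalit1987, II.4.12 (p. 66–67)] -/
theorem hcent_absRayAdicTower (s : ℕ) :
    ∀ m, ∀ g : absoluteGaloisGroup K, ∀ u ∈ (absRayAdicTower h𝔪' v).U s,
      g * u * g⁻¹ * u⁻¹ ∈ (absRayAdicTower h𝔪' v).U m :=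
  fun m g u _ ↦ commutator_mem_absRayAdicTower_U h𝔪' v m g u

end Tower

/-! ### §2. At a place with `𝒪_v ≅ ℤ₂`: `K(𝔪v) = K(𝔪)`, i.e. `Gal(K̄/K(𝔪))` IS the top level `U_0` -/

section DegreeOne

variable [IsTotallyComplex K] {𝔪 : Ideal (𝓞 K)} {v : HeightOneSpectrum (𝓞 K)} (h𝔪 : 𝔪 ≠ ⊥)
  (hv : ¬ 𝔪 ≤ v.asIdeal) (hw : ∀ u : (𝓞 K)ˣ, (u : 𝓞 K) - 1 ∈ 𝔪 → u = 1)

/-- Every unit of `ℤ₂` reduces to `1` modulo `2`: `(ℤ/2)ˣ = 1` (private plumbing). [folklore] -/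
private theorem toZModPow_one_eq_one_of_isUnit_two (x : ℤ_[2]) (hx : IsUnit x) :
    PadicInt.toZModPow 1 x = 1 := by
  have hu : IsUnit (PadicInt.toZModPow 1 x) := hx.map _
  have key : ∀ y : ZMod (2 ^ 1), y = 0 ∨ y = 1 := by decide
  rcases key (PadicInt.toZModPow 1 x) with h0 | h1
  · rw [h0, isUnit_zero_iff] at hu
    exact absurd hu (by decide)
  · exact h1

include hv hw in
/-- ★ **`Gal(K̄/K(𝔪)) ≤ Gal(K̄/K(𝔪v))` when `𝒪_v ≅ ℤ₂`** (`w_𝔪 = 1`, `v ∤ 𝔪`): the `v`-adic Artin character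
of any `σ` fixing `K(𝔪)` is a unit of `𝒪_v ≅ ℤ₂`, hence `≡ 1 mod v`, hence `σ` fixes `K(𝔪v)`
(`Gal(K(𝔪v)/K(𝔪)) ≅ 𝒪_vˣ/(1 + v𝒪_v) = 𝔽₂ˣ = 1`; de Shalit II.4.17: "`1 + 4ℤ₂` if `p = 2`" — the `Δ` of
II.4.1 is trivial). So `H = U_0` for `GroupDistribution.induceFrom` along `absRayAdicTower h𝔪 v`.
[cite: deShalit1987, II.4.1 (p. 56), II.4.17 (p. 77–78), II.1.9 (p. 43)] -/
theorem ker_le_absRayAdicTower_U_zero_of_padicIntEquiv_two (e : v.adicCompletionIntegers K ≃+* ℤ_[2]) :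
    (absRestrictNormalHom (rayClassField K 𝔪)).ker ≤ (absRayAdicTower h𝔪 v).U 0 := by
  intro σ hσ
  -- level `0` of the tower is `Gal(K̄/K(𝔪v^{0+1}))`; keep the exponent in the form `0 + 1`
  have hunit : IsUnit (e ((rayAdicCharacter h𝔪 hv hw ⟨σ, hσ⟩ : (v.adicCompletionIntegers K)ˣ) :
      v.adicCompletionIntegers K)) :=
    (Units.isUnit (rayAdicCharacter h𝔪 hv hw ⟨σ, hσ⟩)).map e
  have h1 := toZModPow_one_eq_one_of_isUnit_two _ hunit
  have h2 := (toZModPow_map_eq_one_iff_valued e (0 + 1)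
    ((rayAdicCharacter h𝔪 hv hw ⟨σ, hσ⟩ : (v.adicCompletionIntegers K)ˣ) : v.adicCompletionIntegers K)).mp h1
  exact (mem_ker_rayClassField_mul_pow_iff_valued h𝔪 hv hw ⟨σ, hσ⟩ (0 + 1)).mpr h2

include hv hw in
/-- ★ **`U_0 = Gal(K̄/K(𝔪))`**, i.e. `K(𝔪v) = K(𝔪)`, at a place with `𝒪_v ≅ ℤ₂`.
[cite: deShalit1987, II.4.1 (p. 56), II.4.17 (p. 77–78)] -/
theorem absRayAdicTower_U_zero_eq_ker (e : v.adicCompletionIntegers K ≃+* ℤ_[2]) :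
    (absRayAdicTower h𝔪 v).U 0 = (absRestrictNormalHom (rayClassField K 𝔪)).ker :=
  le_antisymm (absRayAdicTower_U_le_ker h𝔪 v le_rfl 0)
    (ker_le_absRayAdicTower_U_zero_of_padicIntEquiv_two h𝔪 hv hw e)

include hv hw in
/-- The same read in the relative tower: `(rayAdicTower h𝔪 v).U 0 = ⊤` (every element of `Gal(K̄/K(𝔪))` fixes
`K(𝔪v)`) at a place with `𝒪_v ≅ ℤ₂`. [cite: deShalit1987, II.4.1 (p. 56), II.4.17 (p. 77–78)] -/
theorem rayAdicTower_U_zero_eq_top (e : v.adicCompletionIntegers K ≃+* ℤ_[2]) :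
    (rayAdicTower (𝔪 := 𝔪) h𝔪 v).U 0 = ⊤ := by
  rw [eq_top_iff]
  intro σ _
  rw [mem_rayAdicTower_U_iff]
  exact ker_le_absRayAdicTower_U_zero_of_padicIntEquiv_two h𝔪 hv hw e σ.2

end DegreeOne

end Literature.NumberTheory.NumberFields

end
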